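import Summits.HodgeConjecture.HodgeConjecture.Theorems.F0P3cDyRamFourFrameLawDefs          -- ★ DEFS LEAF №1 «LAW-DEFS»: `StableLawAt`, `KappaAmplitudeLawAt` (+ ★ #0a tokens via its imports)
import Summits.HodgeConjecture.HodgeConjecture.Theorems.F0P3cDyRamFourFrameDictionaryDefs   -- ★ DEFS LEAF №2b «DICTIONARY»: `AnchorCountDictionary` (the (D-G) shape; its ★ group-currency imports)
import HarnessLib

/-!
# Crux `H413`, line LH4 «(D-RAM) FOUR-FRAME» road, STAGE 1a — THE G-SIDE JOINT (GATE 1a-1 §3, ★-grade): laws (S)At + (K-ABS)At at the place + the census dictionary (D-G)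
# ⇒ the four-frame ORBITAL-INTEGRAL sums of the anchor piece (★ tree twin of `F0/P3a/F0P3a-p01/g30/LAWSOCKET-DRAM-FourFrame.v1_1.F0P3ap01g30.lean` 0287a5bf94bf4ddd §3
# `kappaSum_orbitalIntegral_anchor_of_laws`; deal g10-#7)

Cell `hodgecm-mathlib` (D-0151), FLOOR 0, crux item H413 = `stmt-HodgeConjecture-24833`, route of record `HCCMUnconditional`; squad F0∕P3c∕LH4 (req618), dealer LH4-plan
(g10) WORD #2 (R2-4) deal g10-#7; heir LEAD F0P3a-plan DIRECTIVE b9ecbbedecc9c5ae; author of the HOME proof F0P3a-p01 (g30), port LH4-p03 (g11).  THEOREMS ONLY (one theorem;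
no `def`, no instance, no notation, no `sorry`, default heartbeats); imports = ★ LAW-DEFS leaf `Theorems/F0P3cDyRamFourFrameLawDefs.lean` (deal g10-#0b №1: `StableLawAt`,
`KappaAmplitudeLawAt`) + ★ DICTIONARY leaf `Theorems/F0P3cDyRamFourFrameDictionaryDefs.lean` (№2b: the (D-G) shape, opened as the hypothesis `hC`) over ★ `Literature/NumberTheory/Automorphic/UnitaryThreeFourFrameDefs.lean` (p854559: `IsRamifiedQuadraticDatum`,
`IsFourFrameFamily`, `IsElementDatum`, `frameElt`, `fixedVertexCount`, `kappaChar`, `ampl`) + HarnessLib; lane `--supports stmt-HodgeConjecture-24833 --as helper` (count-neutral).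

WHAT IS PROVED.  At a wild ramified non-split place `v` of `L⁺` (`w ∣ v` fixed by complex conjugation, `e(w|v) ≠ 1`, `2 ∉ 𝒪_w^×`), GIVEN the place-wise cuts (S)At
`StableLawAt N₀ σ_w ϖ d t_E` and (K-ABS)At `KappaAmplitudeLawAt N₀ τ σ_w ϖ d t_E` at the datum `IsRamifiedQuadraticDatum σ_w ϖ d t_E` (`σ_w = galAdicCompletionMap c`), and the
census dictionary (D-G) at this place for the type-`tv` anchor subgroup `K_tv` (`tv ∈ {0, 2}`) with its constant `C` (orbital integral of `1_{K_tv}` at a type-(1) literal `[γ_b]`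
`= C ·` ★ `fixedVertexCount σ_w ϖ tv Γ_b`), for every type-(1) four-frame datum `(f, α, β, z, n, k, Γ, γ)`:  (i) the STABLE four-frame sum
`Σ_b Φ(1_{K_tv}, [γ_b]) = C · 4(q^k − 1)∕(q − 1)`;  (ii) for each slot `i` and parity datum `2B = n_i − d + 2 − 2t_E` the κ-WEIGHTED sum `Σ_b κ_i(b)·Φ(1_{K_tv}, [γ_b]) = C · S`
with `S ∈ ℤ`, `|S| = ampl q k B` (`tv = 0`) resp. `ampl q k (B + τ d)` (`tv = 2`); `q = #𝓀(L_w)`.  So the sheet's tokens DO determine orbital-integral statements in ★ currency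
(the desk's letter (L-C) is excluded at the census → integral joint).  PROOF (p01 (g30), ≈ 20 lines, carried verbatim): substitute (D-G) under the sums, pull `C` out, and read
(S)At resp. (K-ABS)At pushed through `ℚ → ℂ`; `S := Σ_b κ_i(b)·n_tv(Γ_b)`.

HONEST LABEL.  Count-neutral: (S)At, (K-ABS)At are CENSUS LAWS OF RECORD (memo v1.2 86c7f5a26f424de2 ∕ book v1.4 4b231cd3d1b58b69) — PROVER TARGETS typed summit-side in
LAW-DEFS, not literature facts — and (D-G) is the (ii-G)+(ii-0) dictionary debt; the verdict of record for (D-RAM) stays PRINT [LanglandsShelstad1989 Thm. p. 484 ∕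
Rogawski1990 Prop. 4.9.1 (a)] ∕ XL; `HC_CM` is proved only modulo the 7 printed citations (2 remaining: hLiu418 = `stmt-HodgeConjecture-24832`, h413 =
`stmt-HodgeConjecture-24833`) until rung 0 closes.

## References
* [Rogawski1990] J. D. Rogawski, *Automorphic Representations of Unitary Groups in Three Variables*, Ann. of Math. Stud. 123 (1990): §4.9 Prop. 4.9.1 (a) p. 55; §8.1
  Prop. 8.1.2 (b) p. 113, p. 116 (germs at the identity).
* [Kottwitz1986] R. Kottwitz, *Stable trace formula: elliptic singular terms*, Math. Ann. 275 (1986): §3 (κ-signs over `ker(H¹(F,T) → H¹(F,G))`).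
-/



noncomputable section

namespace Summit.HodgeConjecture.HodgeConjecture.Cruxes.H413.F0P3cDyRamKappaSumAnchorOfLaws

open MeasureTheory Measure NumberField IsDedekindDomain Topology Filter
open Literature.NumberTheory.Automorphic Literature.NumberTheory.Automorphic.UnitaryGroup Literature.NumberTheory.Automorphic.IntegralReduction
open Literature.NumberTheory.Automorphic.UnitaryLatticeTree Literature.NumberTheory.Automorphic.HermitianLattice
open Literature.NumberTheory.Rogawski1990 Literature.NumberTheory.GaloisRepresentations
open Literature.MeasureTheory.Group (descConj)
open Literature.NumberTheory.Automorphic.UnitaryThreeFourFrame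
open scoped Matrix MatrixGroups Classical ValuativeRel WithZero
open Summit.HodgeConjecture.HodgeConjecture.Cruxes.H413.F0P3cDyRamFourFrameLawDefs
open Summit.HodgeConjecture.HodgeConjecture.Cruxes.H413.F0P3cDyRamFourFrameDictionaryDefs

/-- **§3 · `kappaSum_orbitalIntegral_anchor_of_laws` (PROVED, no sorry) — SIGSHEET TOKENS ⇒ AN ORBITAL-INTEGRAL STATEMENT IN ★ CURRENCY.**  At a wild place, GIVEN the
place-wise cuts (S)At and (K-ABS)At at the datum `(L_w, σ_w, ϖ, d, t_E)` and the census dictionary (D-G) for the type-`tv` anchor subgroup `K_tv` with constant `C`, for every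
type-(1) four-frame datum `(f, α, β, z, n, k, Γ, γ)`:  (i) the STABLE four-frame sum `Σ_b Φ(1_{K_tv}, [γ_b]) = C · 4(q^k − 1)∕(q − 1)`;  (ii) for each slot `i` and
`2B = n_i − d + 2 − 2t_E` the κ-WEIGHTED sum `Σ_b κ_i(b) Φ(1_{K_tv}, [γ_b]) = C · S` with `S ∈ ℤ`, `|S| = ampl q k B` (`tv = 0`) resp. `ampl q k (B + τ d)` (`tv = 2`).
So the sheet's tokens DO determine orbital-integral statements — the desk's (L-C) is excluded at this joint.  `q = #𝓀(L_w)`. -/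
theorem kappaSum_orbitalIntegral_anchor_of_laws
    (L : Type) [Field L] [NumberField L] [IsCMField L]
      {v : HeightOneSpectrum (𝓞 ↥(maximalRealSubfield L))} (w : UnitaryGroup.PlacesOver L v)
      (hw : IsCMField.complexConj L • w.1 = w.1) (_he : v.asIdeal.ramificationIdx' w.1.asIdeal ≠ 1)
      (_h2 : ¬ IsUnit (2 : 𝒪[w.1.adicCompletion L]))
      (ϖ : (w.1.adicCompletion L)) (_hϖ : Valued.v ϖ = WithZero.exp (-1 : ℤ))
      [Fintype (Valued.ResidueField (w.1.adicCompletion L))] (d tE : ℕ) (hD : IsRamifiedQuadraticDatum (galAdicCompletionMap (L := L) (IsCMField.complexConj L) hw) ϖ d tE) (N₀ : ℕ → ℕ) (τ : ℕ → ℤ)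
      (hS : StableLawAt N₀ (galAdicCompletionMap (L := L) (IsCMField.complexConj L) hw) ϖ d tE) (hKA : KappaAmplitudeLawAt N₀ τ (galAdicCompletionMap (L := L) (IsCMField.complexConj L) hw) ϖ d tE)
      [MeasurableSpace ((UnitaryGroup.cmDatum L 3 (Matrix.of fun i j : Fin 3 => if i.val + j.val + 1 = 3 then (1 : L) else 0)).Local v)] [BorelSpace ((UnitaryGroup.cmDatum L 3 (Matrix.of fun i j : Fin 3 => if i.val + j.val + 1 = 3 then (1 : L) else 0)).Local v)]
      [∀ γ : ((UnitaryGroup.cmDatum L 3 (Matrix.of fun i j : Fin 3 => if i.val + j.val + 1 = 3 then (1 : L) else 0)).Local v), MeasurableSpace (((UnitaryGroup.cmDatum L 3 (Matrix.of fun i j : Fin 3 => if i.val + j.val + 1 = 3 then (1 : L) else 0)).Local v) ⧸ Subgroup.centralizer ({γ} : Set ((UnitaryGroup.cmDatum L 3 (Matrix.of fun i j : Fin 3 => if i.val + j.val + 1 = 3 then (1 : L) else 0)).Local v)))]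
      [∀ γ : ((UnitaryGroup.cmDatum L 3 (Matrix.of fun i j : Fin 3 => if i.val + j.val + 1 = 3 then (1 : L) else 0)).Local v), BorelSpace (((UnitaryGroup.cmDatum L 3 (Matrix.of fun i j : Fin 3 => if i.val + j.val + 1 = 3 then (1 : L) else 0)).Local v) ⧸ Subgroup.centralizer ({γ} : Set ((UnitaryGroup.cmDatum L 3 (Matrix.of fun i j : Fin 3 => if i.val + j.val + 1 = 3 then (1 : L) else 0)).Local v)))]
      (mG₃ : OrbitalMeasureFamily ((UnitaryGroup.cmDatum L 3 (Matrix.of fun i j : Fin 3 => if i.val + j.val + 1 = 3 then (1 : L) else 0)).Local v)) (tv : ℕ) (htv : tv = 0 ∨ tv = 2) (Kt : Subgroup ((UnitaryGroup.cmDatum L 3 (Matrix.of fun i j : Fin 3 => if i.val + j.val + 1 = 3 then (1 : L) else 0)).Local v)) (C : ℂ)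
      -- the census dictionary (D-G) AT this place, anchor and constant (its `∃ C` opened)
      (hC : ∀ (f : Fin 4 → Fin 3 → (Fin 3 → (w.1.adicCompletion L))), IsFourFrameFamily (galAdicCompletionMap (L := L) (IsCMField.complexConj L) hw) f →
        ∀ (α β z : (w.1.adicCompletion L)), α * (galAdicCompletionMap (L := L) (IsCMField.complexConj L) hw) α = 1 → β * (galAdicCompletionMap (L := L) (IsCMField.complexConj L) hw) β = 1 → z * (galAdicCompletionMap (L := L) (IsCMField.complexConj L) hw) z = 1 → α ≠ β → α ≠ 1 → β ≠ 1 →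
        ∀ (b : Fin 4) (Γ : GL (Fin 3) (w.1.adicCompletion L)), (Γ : Matrix (Fin 3) (Fin 3) (w.1.adicCompletion L)) = frameElt (galAdicCompletionMap (L := L) (IsCMField.complexConj L) hw) f b α β →
        ∀ (γ : ((UnitaryGroup.cmDatum L 3 (Matrix.of fun i j : Fin 3 => if i.val + j.val + 1 = 3 then (1 : L) else 0)).Local v)), ((((localNonsplitEquiv (IsCMField.complexConj L) (Matrix.of fun i j : Fin 3 => if i.val + j.val + 1 = 3 then (1 : L) else 0) (IsCMField.complexConj_ne_one L) w hw γ :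
              ↥(unitaryGroupOfForm (galAdicCompletionMap (L := L) (IsCMField.complexConj L) hw) (placeForm (Matrix.of fun i j : Fin 3 => if i.val + j.val + 1 = 3 then (1 : L) else 0) w.1))) : GL (Fin 3) (w.1.adicCompletion L)) : Matrix (Fin 3) (Fin 3) (w.1.adicCompletion L))) = z • (Γ : Matrix (Fin 3) (Fin 3) (w.1.adicCompletion L)) →
          classOrbitalIntegral mG₃ (Set.indicator (Kt : Set ((UnitaryGroup.cmDatum L 3 (Matrix.of fun i j : Fin 3 => if i.val + j.val + 1 = 3 then (1 : L) else 0)).Local v)) (fun _ => (1 : ℂ))) (ConjClasses.mk γ) = C * (fixedVertexCount (galAdicCompletionMap (L := L) (IsCMField.complexConj L) hw) ϖ tv Γ : ℂ))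
      -- a type-(1) four-frame datum
      (f : Fin 4 → Fin 3 → (Fin 3 → (w.1.adicCompletion L))) (hf : IsFourFrameFamily (galAdicCompletionMap (L := L) (IsCMField.complexConj L) hw) f)
      (α β z : (w.1.adicCompletion L)) (hz : z * (galAdicCompletionMap (L := L) (IsCMField.complexConj L) hw) z = 1) (n₁ n₂ n₃ : ℕ) (hE : IsElementDatum (galAdicCompletionMap (L := L) (IsCMField.complexConj L) hw) ϖ (N₀ d) α β n₁ n₂ n₃)
      (k : ℕ) (hk : 2 * k + d = n₁ + n₂ + n₃ + 2)
      (Γ : Fin 4 → GL (Fin 3) (w.1.adicCompletion L)) (hΓ : ∀ b, (Γ b : Matrix (Fin 3) (Fin 3) (w.1.adicCompletion L)) = frameElt (galAdicCompletionMap (L := L) (IsCMField.complexConj L) hw) f b α β)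
      (γ : Fin 4 → ((UnitaryGroup.cmDatum L 3 (Matrix.of fun i j : Fin 3 => if i.val + j.val + 1 = 3 then (1 : L) else 0)).Local v)) (hγ : ∀ b, ((((localNonsplitEquiv (IsCMField.complexConj L) (Matrix.of fun i j : Fin 3 => if i.val + j.val + 1 = 3 then (1 : L) else 0) (IsCMField.complexConj_ne_one L) w hw (γ b) :
              ↥(unitaryGroupOfForm (galAdicCompletionMap (L := L) (IsCMField.complexConj L) hw) (placeForm (Matrix.of fun i j : Fin 3 => if i.val + j.val + 1 = 3 then (1 : L) else 0) w.1))) : GL (Fin 3) (w.1.adicCompletion L)) : Matrix (Fin 3) (Fin 3) (w.1.adicCompletion L))) = z • (Γ b : Matrix (Fin 3) (Fin 3) (w.1.adicCompletion L))) :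
    (∑ b : Fin 4, classOrbitalIntegral mG₃ (Set.indicator (Kt : Set ((UnitaryGroup.cmDatum L 3 (Matrix.of fun i j : Fin 3 => if i.val + j.val + 1 = 3 then (1 : L) else 0)).Local v)) (fun _ => (1 : ℂ))) (ConjClasses.mk (γ b)) = C * (4 * ((Fintype.card (Valued.ResidueField (w.1.adicCompletion L)) : ℂ) ^ k - 1) / ((Fintype.card (Valued.ResidueField (w.1.adicCompletion L)) : ℂ) - 1))) ∧
    (∀ (i : Fin 3) (B : ℤ), 2 * B = ((![n₁, n₂, n₃] : Fin 3 → ℕ) i : ℤ) - d + 2 - 2 * tE →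
      ∃ S : ℤ, |(S : ℚ)| = ampl (Fintype.card (Valued.ResidueField (w.1.adicCompletion L))) k (if tv = 0 then B else B + τ d) ∧
        ∑ b : Fin 4, (kappaChar i b : ℂ) * classOrbitalIntegral mG₃ (Set.indicator (Kt : Set ((UnitaryGroup.cmDatum L 3 (Matrix.of fun i j : Fin 3 => if i.val + j.val + 1 = 3 then (1 : L) else 0)).Local v)) (fun _ => (1 : ℂ))) (ConjClasses.mk (γ b)) = C * (S : ℂ)) := by
  obtain ⟨hαn, hβn, hαβ, hα1, hβ1, -⟩ := id hE
  have hO : ∀ b, classOrbitalIntegral mG₃ (Set.indicator (Kt : Set ((UnitaryGroup.cmDatum L 3 (Matrix.of fun i j : Fin 3 => if i.val + j.val + 1 = 3 then (1 : L) else 0)).Local v)) (fun _ => (1 : ℂ))) (ConjClasses.mk (γ b)) = C * (fixedVertexCount (galAdicCompletionMap (L := L) (IsCMField.complexConj L) hw) ϖ tv (Γ b) : ℂ) :=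
    fun b => hC f hf α β z hαn hβn hz hαβ hα1 hβ1 b (Γ b) (hΓ b) (γ b) (hγ b)
  refine ⟨?_, fun i B hB => ?_⟩
  · simp_rw [hO]
    rw [← Finset.mul_sum]
    congr 1
    have h := hS hD f hf α β n₁ n₂ n₃ hE Γ hΓ k hk tv htv
    have h' := congrArg (fun x : ℚ => (x : ℂ)) h
    push_cast at h'
    exact h'
  · obtain ⟨h0, h2⟩ := hKA hD f hf α β n₁ n₂ n₃ hE Γ hΓ k hk i B hB
    refine ⟨∑ b : Fin 4, kappaChar i b * (fixedVertexCount (galAdicCompletionMap (L := L) (IsCMField.complexConj L) hw) ϖ tv (Γ b) : ℤ), ?_, ?_⟩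
    · rcases htv with rfl | rfl
      · rw [if_pos rfl]; exact h0
      · rw [if_neg (by decide)]; exact h2
    · simp_rw [hO]
      push_cast
      rw [Finset.mul_sum]
      exact Finset.sum_congr rfl fun b _ => by ring

end Summit.HodgeConjecture.HodgeConjecture.Cruxes.H413.F0P3cDyRamKappaSumAnchorOfLaws

end
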